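import Literature.Analysis.Complex.RootsOfUnityComplementLocalSections
import HarnessLib

/-!
# CDT Proposition 3.0.1, algebraization: root systems of a `G`-invariant function and hypothesis (iii)

`Literature/Analysis/Complex/RootsOfUnityComplementLocalRootSystems.lean` — PROOF-ONLY (no definition,
no named fact). Second half of brick B5-α2 of the crux memo `Lines/cdt_thm1-core-map-g39.md` (K★ 22226).
F. Calegari, V. Dimitrov, Y. Tang, *The unbounded denominators conjecture*, J. Amer. Math. Soc. 38 (2025),
proof of Proposition 3.0.1 and Remark 3.0.2: a holomorphic function `h` on `ℍ` with finitely many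
"conjugates" `h(t • ·)`, `t ∈ T ⊂ SL(2, ℤ)` (closed under the deck group `Λ_N` of the uniformizer
`x̂ = 16^{1/N}(λ/16)^{1/N}` up to permutation — in the application the right cosets of `G ∩ Λ_N`), each of
cusp width dividing `2N` at `i∞` and bounded there, pulls back along `φ = 16^{-1/N} F_N(r·)` to a function
holomorphic on the closed unit disc: ★ `exists_taylor_subst_eq_of_invariant` gives, for every
`f ∈ ℚ⟦x⟧` with `f(x(t)) = 𝓣(cuspFunction (2N) h)` (the `t = q^{1/N}`-expansion of `h` rewritten in the
uniformizer), the hypothesis (iii) datum `han` of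
`CalegariDimitrovTang2025_unboundedDenominators.dim_le_unconditional`. Ingredients: the root multiset
`{h(t • τ)}_{t ∈ T}` over the fibre `x̂ τ = w` (independent of the fibre point), local holomorphic root
systems away from `0` (local sections, `RootsOfUnityComplementLocalSections`) and at `0` (the
`q`-expansions at width `2N`, `ModularLambdaRootCompetitor`), the continuation theorem
`exists_holomorphic_extension_of_local_root_systems` and the formal bridge
`exists_taylor_subst_eq_of_continuation`.

## References
* [CalegariDimitrovTang2025] F. Calegari, V. Dimitrov, Y. Tang, J. Amer. Math. Soc. 38 (2025), proof of
  Proposition 3.0.1 and Remark 3.0.2 (arXiv v1 Proposition 15, Remark 16).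
-/

noncomputable section

open Complex Real Filter Topology Function Metric Set
open UpperHalfPlane hiding I
open scoped Real Topology Manifold MatrixGroups

namespace Literature.Analysis.Complex

open _root_.Complex Literature.NumberTheory.Automorphic Literature.NumberTheory.Automorphic.ModularLambda
  ModularGroup

/-- `τ ↦ h (t • τ)` is holomorphic on `ℍ` (private copy; see `RootsOfUnityComplementLocalSections`).
[cite: CalegariDimitrovTang2025, §4.2] -/
private theorem mdifferentiable_comp_sl_smul' {h : ℍ → ℂ} (hh : MDiff h) (t : SL(2, ℤ)) :
    MDiff fun τ : ℍ ↦ h (t • τ) := by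
  have e : (fun τ : ℍ ↦ t • τ) = fun τ ↦ ((t : GL (Fin 2) ℝ)) • τ := by funext τ; rfl
  have hs : MDiff (fun τ : ℍ ↦ t • τ) := by
    rw [e]; exact UpperHalfPlane.mdifferentiable_smul (by simp)
  exact hh.comp hs

/-- ★ **Hypothesis (iii) of CDT Theorem 2.0.1 for a function with finitely many `Λ_N`-conjugates of cusp
width dividing `2N`** (CDT Prop. 3.0.1, algebraization, concrete form). See the module docstring.
[cite: CalegariDimitrovTang2025, Proposition 3.0.1 (proof) and Remark 3.0.2] -/
theorem exists_taylor_subst_eq_of_invariant {N : ℕ} (hN : 0 < N) {Φ : ℂ → ℂ}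
    (hΦ : DifferentiableOn ℂ Φ (ball (0 : ℂ) 1)) (hΦU : MapsTo Φ (ball (0 : ℂ) 1) {z : ℂ | z ^ N ≠ 1})
    (hcov : IsCoveringMap hΦU.restrict) (hΦ0 : Φ 0 = 0)
    {h : ℍ → ℂ} (hh : MDiff h) {T : Finset SL(2, ℤ)} (h1T : (1 : SL(2, ℤ)) ∈ T)
    (hperm : ∀ κ ∈ modularLambdaRootDeck N,
      T.val.map (fun t ↦ fun τ : ℍ ↦ h ((t * κ) • τ)) = T.val.map (fun t ↦ fun τ : ℍ ↦ h (t • τ)))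
    (hper : ∀ t ∈ T, ∀ τ : ℍ, h (t • ((((2 * N : ℕ) : ℝ)) +ᵥ τ)) = h (t • τ))
    (hbdd : ∀ t ∈ T, IsBoundedAtImInfty (fun τ : ℍ ↦ h (t • τ)))
    {L : PowerSeries ℤ} (hL : qExpansion 2 (fun τ : ℍ ↦ modularLambda τ / 16) = L.map (Int.castRingHom ℂ))
    {x : PowerSeries ℚ} (hx0 : PowerSeries.constantCoeff x = 0) (hx1 : PowerSeries.coeff 1 x = 1)
    (hxN : x ^ N = PowerSeries.expand N hN.ne' (L.map (Int.castRingHom ℚ)))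
    {f : PowerSeries ℚ}
    (hfH : (f.map (algebraMap ℚ ℂ)).subst (x.map (algebraMap ℚ ℂ)) =
      PowerSeries.mk fun n ↦ iteratedDeriv n (cuspFunction ((2 * N : ℕ) : ℝ) h) 0 / n.factorial)
    {r : ℝ} (hr0 : 0 < r) (hr1 : r < 1) :
    ∃ g : ℂ → ℂ, AnalyticOnNhd ℂ g (closedBall 0 1) ∧
      (f.map (algebraMap ℚ ℂ)).subst (PowerSeries.mk fun n ↦
          iteratedDeriv n (fun z : ℂ ↦ (((16 : ℝ) ^ (-(N : ℝ)⁻¹) : ℝ) : ℂ) * Φ ((r : ℂ) * z)) 0 /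
            n.factorial) =
        PowerSeries.mk fun n ↦ iteratedDeriv n g 0 / n.factorial := by
  classical
  have hN' : N ≠ 0 := hN.ne'
  have hb : ball (0 : ℂ) 1 ∈ 𝓝 (0 : ℂ) := ball_mem_nhds _ one_pos
  have h2Npos : (0 : ℝ) < ((2 * N : ℕ) : ℝ) := by exact_mod_cast (by omega : 0 < 2 * N)
  set c : ℂ := (((16 : ℝ) ^ ((N : ℝ)⁻¹) : ℝ) : ℂ) with hc
  have hc0 : c ≠ 0 := by
    rw [hc]; exact_mod_cast (by positivity : (0 : ℝ) < (16 : ℝ) ^ ((N : ℝ)⁻¹)).ne'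
  -- the competitor `F = c Ψ`, `Ψ = cuspFunction (2N) x`
  obtain ⟨hΨd, hΨe, hΨ0, hΨ1, hΨpow⟩ := cuspFunction_modularLambdaRoot_spec hN'
  set Ψ : ℂ → ℂ := cuspFunction ((2 * N : ℕ) : ℝ) (modularLambdaRoot N) with hΨ
  set F : ℂ → ℂ := fun t ↦ c * Ψ t with hF
  have hFd : DifferentiableOn ℂ F (ball (0 : ℂ) 1) := hΨd.const_mul c
  have hF0 : F 0 = 0 := by simp [hF, hΨ0]
  have hF'0 : deriv F 0 ≠ 0 := by
    rw [hF, deriv_const_mul _ (hΨd.differentiableAt hb), hΨ1, mul_one]; exact hc0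
  have hFU : MapsTo F (ball (0 : ℂ) 1) {z : ℂ | z ^ N ≠ 1} :=
    mapsTo_rpow_mul_cuspFunction_modularLambdaRoot hN'
  have hFe : ∀ τ : ℍ, F (Complex.exp (π * Complex.I * τ / N)) = c * modularLambdaRoot N τ := by
    intro τ; simp only [hF, hΨe τ]
  -- the cusp functions `H_t` of the conjugates
  set Ht : SL(2, ℤ) → ℂ → ℂ := fun t ↦ cuspFunction ((2 * N : ℕ) : ℝ) (fun τ : ℍ ↦ h (t • τ)) with hHt
  have hHtd : ∀ t ∈ T, DifferentiableOn ℂ (Ht t) (ball (0 : ℂ) 1) := fun t ht ↦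
    differentiableOn_cuspFunction_width hN' (hper t ht) (mdifferentiable_comp_sl_smul' hh t) (hbdd t ht)
  have hHte : ∀ t ∈ T, ∀ τ : ℍ, Ht t (Complex.exp (π * Complex.I * τ / N)) = h (t • τ) := fun t ht τ ↦
    cuspFunction_apply_exp hN' (hper t ht) τ
  -- the root data
  set roots : ℂ → Multiset ℂ := fun w ↦
    if hw : w ≠ 0 ∧ w ^ N ≠ 1 then
      T.val.map (fun t ↦ h (t • Classical.choose (exists_rpow_mul_modularLambdaRoot_eq hN' hw.1 hw.2)))
    else if w = 0 then T.val.map (fun t ↦ Ht t 0) else 0 with hroots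
  have hcard : ∀ w, Multiset.card (roots w) ≤ T.card := by
    intro w
    simp only [hroots]
    split_ifs
    · rw [Multiset.card_map, Finset.card_val]
    · rw [Multiset.card_map, Finset.card_val]
    · exact (Multiset.card_zero.le).trans (Nat.zero_le _)
  -- R1: the roots over `x̂ τ`
  have R1 : ∀ τ : ℍ, roots (c * modularLambdaRoot N τ) = T.val.map (fun t ↦ h (t • τ)) := by
    intro τ
    have hw : c * modularLambdaRoot N τ ≠ 0 ∧ (c * modularLambdaRoot N τ) ^ N ≠ 1 :=
      ⟨mul_ne_zero hc0 (modularLambdaRoot_ne_zero N τ), rpow_mul_modularLambdaRoot_pow_ne_one hN' τ⟩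
    simp only [hroots, dif_pos hw]
    set τ' := Classical.choose (exists_rpow_mul_modularLambdaRoot_eq hN' hw.1 hw.2) with hτ'
    have hτ'eq : c * modularLambdaRoot N τ' = c * modularLambdaRoot N τ :=
      Classical.choose_spec (exists_rpow_mul_modularLambdaRoot_eq hN' hw.1 hw.2)
    obtain ⟨γ, hγ, hγτ⟩ := exists_deck_smul_eq_of_rpow_mul_modularLambdaRoot_eq hN' hτ'eq
    -- `τ' = γ • τ`
    have e1 : T.val.map (fun t ↦ h (t • τ')) = (T.val.map (fun t ↦ fun σ : ℍ ↦ h ((t * γ) • σ))).map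
        (fun g ↦ g τ) := by
      rw [Multiset.map_map]
      refine Multiset.map_congr rfl fun t _ ↦ ?_
      simp only [comp_apply, mul_smul, hγτ]
    rw [e1, hperm γ hγ, Multiset.map_map]
    rfl
  -- an enumeration of `T`
  set e : Fin T.card ≃ T := T.equivFin.symm with he
  -- local holomorphic root systems everywhere on `{w | wᴺ ≠ 1}`
  have hloc : ∀ w₀ : ℂ, w₀ ^ N ≠ 1 → ∃ ε > 0, ∃ (m : ℕ) (Y : Fin m → ℂ → ℂ),
      (∀ i, DifferentiableOn ℂ (Y i) (ball w₀ ε)) ∧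
      (∀ i, ∀ w ∈ ball w₀ ε, w ^ N ≠ 1 → Y i w ∈ roots w) ∧
      (∀ w ∈ ball w₀ ε, w ^ N ≠ 1 → ∀ y ∈ roots w, ∃ i, y = Y i w) := by
    intro w₀ hw₀
    rcases eq_or_ne w₀ 0 with rfl | hw₀0
    · -- R3: at the cusp, through the `q`-expansions `H_t` and the local inverse of `F`
      have hFan : AnalyticAt ℂ F 0 := hFd.analyticAt hb
      set φ₀ : ℂ → ℂ := hFan.hasStrictDerivAt.localInverse F (deriv F 0) 0 hF'0 with hφ₀
      have hφan : AnalyticAt ℂ φ₀ 0 := by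
        have h := hFan.analyticAt_localInverse hF'0
        rwa [hF0] at h
      have hright : ∀ᶠ w in 𝓝 0, F (φ₀ w) = w := by
        have h := hFan.hasStrictDerivAt.eventually_right_inverse hF'0
        rwa [hF0] at h
      have hφ0 : φ₀ 0 = 0 := by
        have h := HasStrictFDerivAt.localInverse_apply_image
          (hFan.hasStrictDerivAt.hasStrictFDerivAt_equiv hF'0)
        rw [hF0] at h
        exact h
      have hφt : Tendsto φ₀ (𝓝 0) (𝓝 0) := by simpa [ContinuousAt, hφ0] using hφan.continuousAt
      obtain ⟨U, hUn, hUan⟩ := hφan.exists_mem_nhds_analyticOnNhd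
      obtain ⟨ε, hε, hball⟩ :=
        Metric.mem_nhds_iff.mp (Filter.inter_mem hUn (Filter.inter_mem hright (hφt.eventually hb)))
      refine ⟨ε, hε, T.card, fun i w ↦ Ht (e i) (φ₀ w), fun i ↦ ?_, fun i w hw hw1 ↦ ?_,
        fun w hw hw1 y hy ↦ ?_⟩
      · exact (hHtd _ (e i).2).comp (fun w hw ↦ (hUan w (hball hw).1).differentiableAt.differentiableWithinAt)
          fun w hw ↦ (hball hw).2.2
      · have hr : F (φ₀ w) = w := (hball hw).2.1
        have hb1 : φ₀ w ∈ ball (0 : ℂ) 1 := (hball hw).2.2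
        show Ht (e i) (φ₀ w) ∈ roots w
        rcases eq_or_ne w 0 with rfl | hw0
        · have : roots 0 = T.val.map (fun t ↦ Ht t 0) := by simp [hroots]
          rw [this, hφ0]
          exact Multiset.mem_map.mpr ⟨e i, (e i).2, rfl⟩
        · have hs0 : φ₀ w ≠ 0 := by
            intro h0; rw [h0, hF0] at hr; exact hw0 hr.symm
          obtain ⟨τ, hτ⟩ := exists_exp_eq_of_mem_ball hN' (mem_ball_zero_iff.mp hb1) hs0
          have hwτ : w = c * modularLambdaRoot N τ := by rw [← hr, ← hτ, hFe]
          have hR : roots w = T.val.map (fun t ↦ h (t • τ)) := by rw [hwτ]; exact R1 τ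
          rw [hR, ← hτ, hHte _ (e i).2]
          exact Multiset.mem_map.mpr ⟨e i, (e i).2, rfl⟩
      · have hr : F (φ₀ w) = w := (hball hw).2.1
        have hb1 : φ₀ w ∈ ball (0 : ℂ) 1 := (hball hw).2.2
        rcases eq_or_ne w 0 with rfl | hw0
        · have : roots 0 = T.val.map (fun t ↦ Ht t 0) := by simp [hroots]
          rw [this] at hy
          obtain ⟨t, ht, rfl⟩ := Multiset.mem_map.mp hy
          refine ⟨e.symm ⟨t, Finset.mem_val.mp ht⟩, ?_⟩
          show Ht t 0 = Ht (e (e.symm ⟨t, _⟩)) (φ₀ 0)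
          rw [hφ0, Equiv.apply_symm_apply]
        · have hs0 : φ₀ w ≠ 0 := by
            intro h0; rw [h0, hF0] at hr; exact hw0 hr.symm
          obtain ⟨τ, hτ⟩ := exists_exp_eq_of_mem_ball hN' (mem_ball_zero_iff.mp hb1) hs0
          have hwτ : w = c * modularLambdaRoot N τ := by rw [← hr, ← hτ, hFe]
          rw [hwτ, R1 τ] at hy
          obtain ⟨t, ht, rfl⟩ := Multiset.mem_map.mp hy
          refine ⟨e.symm ⟨t, Finset.mem_val.mp ht⟩, ?_⟩
          show h (t • τ) = Ht (e (e.symm ⟨t, _⟩)) (φ₀ w)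
          rw [Equiv.apply_symm_apply, ← hτ, hHte _ (Finset.mem_val.mp ht)]
    · -- R2: away from the cusp, through a holomorphic local section of `x̂`
      obtain ⟨τ₀, hτ₀⟩ := exists_rpow_mul_modularLambdaRoot_eq hN' hw₀0 hw₀
      obtain ⟨ε, ψ₀, hε, hψd, hψ0, hψ⟩ := exists_local_section_rpow_mul_modularLambdaRoot hN' τ₀
      rw [hτ₀] at hψd hψ0 hψ
      refine ⟨ε, hε, T.card, fun i w ↦ h ((e i : SL(2, ℤ)) • ofComplex (ψ₀ w)), fun i ↦ ?_,
        fun i w hw _ ↦ ?_, fun w hw _ y hy ↦ ?_⟩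
      · have hg : DifferentiableOn ℂ ((fun τ : ℍ ↦ h ((e i : SL(2, ℤ)) • τ)) ∘ ofComplex) {z : ℂ | 0 < z.im} :=
          UpperHalfPlane.mdifferentiable_iff.mp (mdifferentiable_comp_sl_smul' hh _)
        exact hg.comp hψd fun w hw ↦ (hψ w hw).1
      · obtain ⟨him, hsec⟩ := hψ w hw
        have hR := R1 ⟨ψ₀ w, him⟩
        rw [hsec] at hR
        show h ((e i : SL(2, ℤ)) • ofComplex (ψ₀ w)) ∈ roots w
        rw [hR, ofComplex_apply_of_im_pos him]
        exact Multiset.mem_map.mpr ⟨e i, (e i).2, rfl⟩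
      · obtain ⟨him, hsec⟩ := hψ w hw
        have hR := R1 ⟨ψ₀ w, him⟩
        rw [hsec] at hR
        rw [hR] at hy
        obtain ⟨t, ht, rfl⟩ := Multiset.mem_map.mp hy
        refine ⟨e.symm ⟨t, Finset.mem_val.mp ht⟩, ?_⟩
        show h (t • _) = h ((e (e.symm ⟨t, _⟩) : SL(2, ℤ)) • ofComplex (ψ₀ w))
        rw [Equiv.apply_symm_apply, ofComplex_apply_of_im_pos him]
  -- R4: the germ `H = cuspFunction (2N) h`
  set H : ℂ → ℂ := cuspFunction ((2 * N : ℕ) : ℝ) h with hH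
  have hH1 : Ht 1 = H := by
    simp only [hHt, hH, one_smul]
  have hHd : DifferentiableOn ℂ H (ball (0 : ℂ) 1) := by rw [← hH1]; exact hHtd 1 h1T
  have hHmem : ∀ t ∈ ball (0 : ℂ) 1, ‖t‖ < 1 → H t ∈ roots (F t) := by
    intro t ht _
    rcases eq_or_ne t 0 with rfl | ht0
    · have : roots 0 = T.val.map (fun t ↦ Ht t 0) := by simp [hroots]
      rw [hF0, this, ← hH1]
      exact Multiset.mem_map.mpr ⟨1, h1T, rfl⟩
    · obtain ⟨τ, hτ⟩ := exists_exp_eq_of_mem_ball hN' (mem_ball_zero_iff.mp ht) ht0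
      rw [← hτ, hFe, R1, ← hH1, hHte 1 h1T, one_smul]
      exact Multiset.mem_map.mpr ⟨1, h1T, by rw [one_smul]⟩
  -- continuation over the disc, then the formal bridge
  obtain ⟨ω, y, hωd, -, hω0, hΦω, hyd, -, hyω⟩ :=
    exists_holomorphic_extension_of_local_root_systems hΦ hΦU hcov hΦ0 hFd hF0 hF'0 hFU roots hcard
      hloc one_pos hHd hHmem
  have hHan : AnalyticAt ℂ H 0 := hHd.analyticAt hb
  exact exists_taylor_subst_eq_of_continuation hN hΦ hΨd hΨ0 hΨ1 hΨpow hωd hω0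
    (fun t ht ↦ by rw [hΦω t ht]) hL hx0 hx1 hxN hHan hfH hyd hyω hr0 hr1

end Literature.Analysis.Complex

end
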